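import Literature.Geometry.Lorentzian.ChartConnection
import Literature.Geometry.Lorentzian.CoordScalarCurvatureEvolution
import HarnessLib

/-!
# The abstract curvature objects of a metric on `U : Opens E` are the coordinate objects of its components

Link file between the abstract pseudo-Riemannian calculus of `LeviCivita.lean` /
`Curvature.lean` computed in a chart (`ChartCalculus.lean`, `ChartConnection.lean`,
`ChartCurvature.lean`, `ChartScalarCurvature.lean`: `OpensChart.koszulForm`, `christoffel`,
`val_riemann_eq`, `ricci_eq_sum`, `scalarCurvature_eq_coord`) and the coordinate tensor calculus
of the components alone (`CoordCurvature.lean` ff.: `MetricCoord.sharpAt`, `chrAt`, `riemAt`,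
`ricAt`, `scalAt`, `hessAt`, `lapAt`, `normSqAt`). For a `C^∞` metric `g` on `U : Opens E` with
representative `G` (`g.val y = G y` on `U`) we prove that the two stacks agree:

* `isMetricOn_repr` — `G` is smooth, symmetric and nondegenerate on `U` (`MetricCoord.IsMetricOn`);
* `sharp_eq_sharpAt`, `christoffel_eq_chrAt` (`christoffel g G x Y X = chrAt G x X Y`),
  `koszulForm_eq_koszulCLM`;
* `riemann_eq_riemAt` — `g.riemann x X Y Z = riemAt G x X Y Z` (curvature of the Levi-Civita
  connection on constant fields, `leviCivita_apply_eq`);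
* `ricci_eq_ricAt`, `scalarCurvature_eq_scalAt`, `hessian_eq_hessAt`, `dalembertian_eq_lapAt`,
  `normSq_ricci_eq_normSqAt`.

So every identity proved for the components (Bianchi identities, `dS = 2 div Ric`, the
variation formulas and the coordinate form of Topping's Prop. 2.5.4) is an identity of the
abstract objects of `g`. Everything is proved; no new definition.

## References

* B. O'Neill, *Semi-Riemannian geometry with applications to relativity*, 1983, Ch. 3,
  Prop. 3.13, Lemma 3.38, Lemma 3.49, Lemma 3.52, Def. 3.53. [ONeill1983]
-/

noncomputable section

set_option maxSynthPendingDepth 3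

open Bundle Set Function Filter FiberBundle VectorField ContinuousLinearMap TopologicalSpace
open scoped Manifold ContDiff Topology

namespace Literature.Geometry.Lorentzian

namespace OpensChart

variable {E : Type*} [NormedAddCommGroup E] [NormedSpace ℝ E] [FiniteDimensional ℝ E]
  [CompleteSpace E] {U : Opens E}
  {g : PseudoRiemannianMetric 𝓘(ℝ, E) ∞ E (TangentSpace 𝓘(ℝ, E) : U → Type _)}
  {G : E → E →L[ℝ] E →L[ℝ] ℝ} (hG : ∀ y : U, g.val y = G y)

include hG

omit [CompleteSpace E] in
/-- **The representative of a smooth metric on `U` is smooth, symmetric and nondegenerate on `U`**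
in the sense of `MetricCoord.IsMetricOn`. [cite: ONeill1983, Ch. 3, Def. 3.1] -/
theorem isMetricOn_repr : MetricCoord.IsMetricOn G (U : Set E) where
  isOpen := U.2
  contDiffOn y hy := (contDiffAt_repr hG ⟨y, hy⟩).contDiffWithinAt
  symm y hy v w := by
    have h := g.symm ⟨y, hy⟩ v w
    rw [hG] at h
    exact h
  isInvertible y hy := by
    refine MetricCoord.isInvertible_of_nondegenerate fun v hv ↦ ?_
    refine g.nondegenerate ⟨y, hy⟩ v fun w ↦ ?_
    rw [hG]
    exact hv w

omit [CompleteSpace E] in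
/-- `G x` is invertible at the points of `U`. [folklore] -/
theorem isInvertible_repr (x : U) : (G x).IsInvertible :=
  (isMetricOn_repr hG).isInvertible x x.2

omit [CompleteSpace E] in
/-- **`♯` of the metric is `sharpAt` of the components**: `g.sharp x α = (G x)⁻¹ α`.
[cite: ONeill1983, Ch. 3, p. 60] -/
theorem sharp_eq_sharpAt (x : U) (α : E →L[ℝ] ℝ) :
    g.sharp x (α : E →ₗ[ℝ] ℝ) = MetricCoord.sharpAt G x α := by
  refine g.sharp_eq_of_forall x _ _ fun w ↦ ?_
  rw [hG]
  exact MetricCoord.apply_sharpAt_apply (isInvertible_repr hG x) α w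

omit hG [FiniteDimensional ℝ E] [CompleteSpace E] in
/-- The Koszul form of `ChartCalculus` is the Koszul trilinear map of `CoordCurvature`, with the
first two slots exchanged in the notation: `koszulForm G x Y X Z = koszulCLM G x X Y Z`. [folklore] -/
theorem koszulForm_eq_koszulCLM (x : E) (X Y Z : E) :
    koszulForm G x Y X Z = MetricCoord.koszulCLM G x X Y Z := rfl

omit [CompleteSpace E] in
/-- **The Christoffel map of `ChartCalculus` is `chrAt`**: `christoffel g G x Y X = Γ_x(X, Y) =
chrAt G x X Y` (both are `♯(½ K(X,Y,·))`). [cite: ONeill1983, Ch. 3, Prop. 3.13] -/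
theorem christoffel_eq_chrAt (x : U) (X Y : E) :
    christoffel g G x Y X = MetricCoord.chrAt G x X Y := by
  rw [christoffel_apply]
  refine g.sharp_eq_of_forall x _ _ fun w ↦ ?_
  rw [hG]
  change G x (MetricCoord.chrAt G x X Y) w = 2⁻¹ * koszulForm G x Y X w
  rw [MetricCoord.apply_chrAt (isInvertible_repr hG x)]
  rfl

omit [CompleteSpace E] in
/-- `christoffel g G x Y = chrAt G x Y` as endomorphisms (torsion-freeness). [cite: ONeill1983, Ch. 3, Prop. 3.13] -/
theorem christoffel_eq_chrAt' (x : U) (Y : E) :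
    christoffel g G x Y = MetricCoord.chrAt G x Y := by
  ext X
  rw [christoffel_eq_chrAt hG x X Y, (isMetricOn_repr hG).chrAt_comm x.2 X Y]

/-- **The Riemann tensor of the metric is `riemAt` of the components**:
`g.riemann x X Y Z = riemAt G x X Y Z` (`R(X,Y)Z = ∇_X∇_Y Z − ∇_Y∇_X Z` on constant fields,
`∇_Y Z = Γ(Y,Z)`, `∇_X W = DW(X) + Γ(X, W)`; O'Neill 1983, Ch. 3, Lemma 3.38).
[cite: ONeill1983, Ch. 3, Lemma 3.38] -/
theorem riemann_eq_riemAt [g.HasLeviCivita] (x : U) (X₀ Y₀ Z₀ : E) :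
    g.riemann x X₀ Y₀ Z₀ = MetricCoord.riemAt G x X₀ Y₀ Z₀ := by
  haveI : IsManifold 𝓘(ℝ, E) (minSmoothness ℝ 3) U := by
    rw [minSmoothness_of_isRCLikeNormedField]; infer_instance
  have hm2 : minSmoothness ℝ 2 = 2 := minSmoothness_of_isRCLikeNormedField
  have hreg : g.leviCivita.IsLocallyContMDiff 1 :=
    g.isLocallyContMDiff_leviCivita_holds 1 (by exact_mod_cast le_top)
  have hGm := isMetricOn_repr hG
  -- constant fields
  set Xc : Π y : U, TangentSpace 𝓘(ℝ, E) y := fun _ ↦ (X₀ : E) with hXc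
  set Yc : Π y : U, TangentSpace 𝓘(ℝ, E) y := fun _ ↦ (Y₀ : E) with hYc
  set Zc : Π y : U, TangentSpace 𝓘(ℝ, E) y := fun _ ↦ (Z₀ : E) with hZc
  -- (1) `curvature_apply` on constant fields; the bracket vanishes
  have hR : g.riemann x X₀ Y₀ Z₀ =
      g.leviCivita (fun y ↦ g.leviCivita Zc y Y₀) x X₀ -
        g.leviCivita (fun y ↦ g.leviCivita Zc y X₀) x Y₀ := by
    have h := g.leviCivita.curvature_apply_of_isLocallyContMDiff (x := x) hreg (X := Xc) (Y := Yc)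
      (Z := Zc) (mdifferentiableAt_const_section x X₀) (mdifferentiableAt_const_section x Y₀)
      (by rw [hm2]; exact contMDiffAt_const_section x Z₀)
    change g.riemann x X₀ Y₀ Z₀ = _ at h
    rw [h]
    simp only [CovariantDerivative.curvatureAux, hXc, hYc, mlieBracket_const, map_zero, sub_zero]
  -- (2) the inner covariant derivatives are Christoffel fields
  have hS : ∀ V₀ : E, (fun y : U ↦ g.leviCivita Zc y V₀) =
      fun y : U ↦ (MetricCoord.chrAt G y V₀ Z₀ : E) := fun V₀ ↦
    funext fun y ↦ by rw [leviCivita_const_const_apply hG y Z₀ V₀, christoffel_eq_chrAt hG y V₀ Z₀]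
  -- (3) the outer ones by `leviCivita_apply_eq`
  have houter : ∀ V₀ T₀ : E,
      g.leviCivita (fun y : U ↦ (MetricCoord.chrAt G y V₀ Z₀ : E)) x T₀ =
        fderiv ℝ (MetricCoord.chrAt G) x T₀ V₀ Z₀ +
          MetricCoord.chrAt G x T₀ (MetricCoord.chrAt G x V₀ Z₀) := by
    intro V₀ T₀
    have hd : DifferentiableAt ℝ (fun y ↦ MetricCoord.chrAt G y V₀ Z₀) x :=
      MetricCoord.differentiableAt_clm_apply_const
        (MetricCoord.differentiableAt_clm_apply_const (hGm.differentiableAt_chrAt x.2) V₀) Z₀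
    rw [leviCivita_apply_eq hG x (W := fun y : U ↦ (MetricCoord.chrAt G y V₀ Z₀ : E))
      (Wf := fun y ↦ MetricCoord.chrAt G y V₀ Z₀) (fun _ ↦ rfl) hd T₀,
      hGm.fderiv_chrAt_apply₂ x.2, christoffel_eq_chrAt hG x T₀]
  rw [hR, hS Y₀, hS X₀, houter Y₀ X₀, houter X₀ Y₀, MetricCoord.riemAt_apply]
  abel

/-- **The Ricci tensor of the metric is `ricAt` of the components.** [cite: ONeill1983, Ch. 3, Lemma 3.52] -/
theorem ricci_eq_ricAt [g.HasLeviCivita] (x : U) (Y₀ Z₀ : E) :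
    g.ricci x Y₀ Z₀ = MetricCoord.ricAt G x Y₀ Z₀ := by
  rw [PseudoRiemannianMetric.ricci_apply, CovariantDerivative.ricci_apply, MetricCoord.ricAt_apply]
  congr 1
  ext v
  exact riemann_eq_riemAt hG x v Y₀ Z₀

omit [CompleteSpace E] in
/-- The metric trace of a bilinear form is the coordinate metric trace of the corresponding
continuous bilinear map. [cite: ONeill1983, Ch. 3, pp. 60–61] -/
theorem trace_eq_mtrAt (x : U) (B : LinearMap.BilinForm ℝ E) (β : E →L[ℝ] E →L[ℝ] ℝ)
    (h : ∀ v w, B v w = β v w) : g.trace x B = MetricCoord.mtrAt G x β := by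
  rw [PseudoRiemannianMetric.trace, MetricCoord.mtrAt]
  congr 1
  ext v
  change g.sharp x (B v) = MetricCoord.sharpAt G x (β v)
  rw [← sharp_eq_sharpAt hG x (β v)]
  congr 1
  ext w
  exact h v w

/-- **The scalar curvature of the metric is `scalAt` of the components.**
[cite: ONeill1983, Ch. 3, Def. 3.53] -/
theorem scalarCurvature_eq_scalAt [g.HasLeviCivita] (x : U) :
    g.scalarCurvature x = MetricCoord.scalAt G x :=
  trace_eq_mtrAt hG x _ _ fun v w ↦ ricci_eq_ricAt hG x v w

omit [CompleteSpace E] in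
/-- **The Hessian of the metric is `hessAt` of the components** (for a function with a `C²`
representative). [cite: ONeill1983, Ch. 3, Lemma 3.49] -/
theorem hessian_eq_hessAt [g.HasLeviCivita] (x : U) {f : U → ℝ} {Φ : E → ℝ}
    (hf : ∀ y : U, f y = Φ y) (hΦ : ContDiffAt ℝ 2 Φ x) (X₀ Y₀ : E) :
    g.hessian f x X₀ Y₀ = MetricCoord.hessAt G Φ x X₀ Y₀ := by
  rw [hessian_eq hG x ((contDiffAt_repr hG x).differentiableAt (by simp)) hf hΦ]
  change fderiv ℝ (fderiv ℝ Φ) x X₀ Y₀ - fderiv ℝ Φ x (christoffel g G x Y₀ X₀) = _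
  rw [christoffel_eq_chrAt hG x X₀ Y₀, MetricCoord.hessAt_apply]

omit [CompleteSpace E] in
/-- **The d'Alembertian / Laplace–Beltrami operator of the metric is `lapAt` of the components.**
[cite: ONeill1983, Ch. 3, Def. 3.50] -/
theorem dalembertian_eq_lapAt [g.HasLeviCivita] (x : U) {f : U → ℝ} {Φ : E → ℝ}
    (hf : ∀ y : U, f y = Φ y) (hΦ : ContDiffAt ℝ 2 Φ x) :
    g.dalembertian f x = MetricCoord.lapAt G Φ x :=
  trace_eq_mtrAt hG x _ _ fun v w ↦ hessian_eq_hessAt hG x hf hΦ v w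

omit [CompleteSpace E] in
/-- The metric square norm of a bilinear form is the coordinate one of the corresponding
continuous bilinear map. [cite: ONeill1983, Ch. 3, pp. 60–61] -/
theorem normSq_eq_normSqAt (x : U) (B : LinearMap.BilinForm ℝ E) (β : E →L[ℝ] E →L[ℝ] ℝ)
    (h : ∀ v w, B v w = β v w) : g.normSq x B = MetricCoord.normSqAt G x β := by
  rw [PseudoRiemannianMetric.normSq, MetricCoord.normSqAt]
  congr 1
  have h1 : ∀ v, g.sharp x (B v) = MetricCoord.sharpAt G x (β v) := fun v ↦ by
    rw [← sharp_eq_sharpAt hG x (β v)]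
    congr 1; ext w; exact h v w
  have h2 : ∀ v, g.sharp x (B.flip v) = MetricCoord.sharpAt G x (β.flip v) := fun v ↦ by
    rw [← sharp_eq_sharpAt hG x (β.flip v)]
    congr 1; ext w; exact h w v
  ext v
  change g.sharp x (B (g.sharp x (B.flip v))) =
    MetricCoord.sharpAt G x (β (MetricCoord.sharpAt G x (β.flip v)))
  rw [h2 v, h1]

/-- **`|Ric|²` of the metric is `normSqAt` of the components at `ricAt`.** [cite: ONeill1983, Ch. 3, pp. 60–61] -/
theorem normSq_ricci_eq_normSqAt [g.HasLeviCivita] (x : U) :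
    g.normSq x (g.ricci x) = MetricCoord.normSqAt G x (MetricCoord.ricAt G x) :=
  normSq_eq_normSqAt hG x _ _ fun v w ↦ ricci_eq_ricAt hG x v w

end OpensChart

end Literature.Geometry.Lorentzian

end
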